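import Summits.HodgeConjecture.CorCM.Census.MultiFieldWeil
import Mathlib.Algebra.Order.BigOperators.Group.Finset
import HarnessLib

/-!
# MULTI-FIELD WEIL, part 2: the DEFECT LAW interface `d_m ≡ t_m`, `e = Σ_m c_m t_m` — balanced at EVERY tuple of permutations; layers and
# conjugate pairs inside a configuration obeying the law

COR-CM (cell `pub-hodgecm2`), seat b30 gen 28 (2026-08-23); count-neutral own lane MULTI-FIELD WEIL ENGINE, sequel of
`Census/MultiFieldWeil.lean` (model `PtG`, `phiG`, `ModelBalancedG`, `cnt`, the signed form).  Theorems of the finite model plus four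
bookkeeping definitions (`lowPos`, `HasDefectsG`, `IsLayerG`, `sgnZ`); no named fact, no geometry, no `sorry`, no `decide`.

THE INTERFACE.  Unknowns of a configuration: the curve defect `e = N(τ) − N(τ̄)` and the field defects `d_m(a) = N⟨m,a,+⟩ − N⟨m,a,−⟩`.
`HasDefectsG c v T t`: `d_m(a) = t_m` for every pair `a` of every field `m`, and `e = Σ_m c_m t_m` (**the defect law** with curve
multiplicities `c_m`).  HOW IT IS OBTAINED is instance-specific group theory on the realised tuples (joint transitivity for coprime relative
degrees, gen 26ʼs counting lemma; a realised rotation of five decic pairs, gen 27; …) and is NOT done here.  WHAT IT GIVES (kernel, here):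
(1) with `n_m = 2|P_m| + c_m` the signed equation holds at EVERY tuple `π` — `Σ_a (π m a ∈ P_m ? t_m : −t_m) = (2|P_m| − n_m) t_m = −c_m t_m`
(`sum_ite_mem_const`) — so the configuration is balanced under every set of tuples (`modelBalancedG_of_hasDefects`: the law does not see
`R`); (2) if all `t_m = 0`, a non-empty configuration contains two points over conjugate model points (`exists_conj_of_hasDefects_zero`);
(3) if `t_{m₀} ≠ 0`, it contains a LAYER of the field `m₀` — one point over each pair, all of the sign `s` of `t_{m₀}`
(`exists_layer_of_hasDefects`, `IsLayerG`).  (2) and (3) are the two moves of the engine `CorCM/MultiFieldWeilEngine.lean`.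
[cite: Pohlmann1968, Thm 1] [cite: GaoUllmo2025, Thm 3.1] [cite: MoonenZarhin1995Duke, Thm. 2.4]

## References
* [Pohlmann1968] H. Pohlmann, Ann. of Math. 88 (1968), Thm 1.  [GaoUllmo2025] Z. Gao, E. Ullmo, J. Inst. Math. Jussieu 25 (2025),
  Thm 3.1.  [MoonenZarhin1995Duke] B. Moonen, Yu. Zarhin, Duke Math. J. 77 (1995), Thm. 2.4.
-/

namespace Summit.HodgeConjecture.CorCM.Census.MultiFieldWeil

open Finset

/-! ### Signed sums through a position set -/

/-- **A permutation hits a position set exactly `|Q|` times.** [folklore] -/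
theorem card_filter_perm_mem {k : ℕ} (σ : Equiv.Perm (Fin k)) (Q : Finset (Fin k)) :
    (univ.filter fun a => σ a ∈ Q).card = Q.card := by
  have h : (univ.filter fun a => σ a ∈ Q) = Q.map σ.symm.toEmbedding := by
    ext a
    simp only [Finset.mem_filter, Finset.mem_univ, true_and, Finset.mem_map_equiv, Equiv.symm_symm]
  rw [h, Finset.card_map]

/-- `Σ_a (σ a ∈ Q ? f a : −f a) = 2 Σ_{σ a ∈ Q} f a − Σ_a f a`. [folklore] -/
theorem sum_ite_mem_eq {k : ℕ} (σ : Equiv.Perm (Fin k)) (Q : Finset (Fin k)) (f : Fin k → ℤ) :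
    (∑ a : Fin k, (if σ a ∈ Q then f a else -f a)) = 2 * (∑ a ∈ univ.filter fun a => σ a ∈ Q, f a) - ∑ a : Fin k, f a := by
  rw [Finset.sum_filter, Finset.mul_sum, eq_sub_iff_add_eq, ← Finset.sum_add_distrib]
  refine Finset.sum_congr rfl fun a _ => ?_
  split_ifs <;> ring

/-- **The signed sum of a CONSTANT through a position set**: `Σ_a (σ a ∈ Q ? t : −t) = (2|Q| − k) t`. [folklore] -/
theorem sum_ite_mem_const {k : ℕ} (σ : Equiv.Perm (Fin k)) (Q : Finset (Fin k)) (t : ℤ) :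
    (∑ a : Fin k, (if σ a ∈ Q then t else -t)) = (2 * (Q.card : ℤ) - k) * t := by
  rw [sum_ite_mem_eq]
  simp only [Finset.sum_const, card_filter_perm_mem, Finset.card_univ, Fintype.card_fin]
  ring

/-! ### Position sets: the first `p` positions -/

/-- **The first `p` positions** of `Fin k` (the standard position set of a type of `k`-signature `(p, k − p)`). [folklore] -/
def lowPos (k p : ℕ) : Finset (Fin k) := univ.filter fun a => (a : ℕ) < p

/-- Membership in `lowPos`. [folklore] -/
theorem mem_lowPos {k p : ℕ} {a : Fin k} : a ∈ lowPos k p ↔ (a : ℕ) < p := by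
  simp [lowPos]

/-- `lowPos k p` is the image of `Fin p` (`p ≤ k`). [folklore] -/
theorem lowPos_eq_map {k p : ℕ} (h : p ≤ k) : lowPos k p = (univ : Finset (Fin p)).map (Fin.castLEEmb h) := by
  ext a
  rw [mem_lowPos, Finset.mem_map]
  constructor
  · intro ha
    exact ⟨⟨a, ha⟩, Finset.mem_univ _, Fin.ext rfl⟩
  · rintro ⟨b, -, rfl⟩
    exact b.isLt

/-- **`|lowPos k p| = p`** (`p ≤ k`). [folklore] -/
theorem card_lowPos {k p : ℕ} (h : p ≤ k) : (lowPos k p).card = p := by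
  rw [lowPos_eq_map h, Finset.card_map, Finset.card_univ, Fintype.card_fin]

/-- `lowPos (k+1) 1 = {0}`. [folklore] -/
theorem mem_lowPos_one {k : ℕ} {a : Fin (k + 1)} : a ∈ lowPos (k + 1) 1 ↔ a = 0 := by
  rw [mem_lowPos, Nat.lt_one_iff, Fin.ext_iff, Fin.val_zero]

/-- `lowPos (k+2) 2 = {0, 1}`. [folklore] -/
theorem mem_lowPos_two {k : ℕ} {a : Fin (k + 2)} : a ∈ lowPos (k + 2) 2 ↔ a = 0 ∨ a = 1 := by
  rw [mem_lowPos, Fin.ext_iff, Fin.ext_iff, Fin.val_zero, Fin.val_one]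
  omega

/-! ### The defect law -/

variable {r : ℕ} {n : Fin r → ℕ} {α : Type*}

/-- **The defect law** for a configuration `(v, T)` of the model with curve multiplicities `c` and defects `t`: every pair `a` of the field
`m` has defect `N⟨m,a,+⟩ − N⟨m,a,−⟩ = t_m`, and the curve defect is `N(τ) − N(τ̄) = Σ_m c_m t_m`. [cite: MoonenZarhin1995Duke, Thm. 2.4]
[cite: GaoUllmo2025, Thm 3.1] -/
def HasDefectsG (c : Fin r → ℕ) (v : α → PtG n) (T : Finset α) (t : Fin r → ℤ) : Prop :=
  (∀ (m : Fin r) (a : Fin (n m)), (cnt v T (Sum.inr ⟨m, (a, true)⟩) : ℤ) - cnt v T (Sum.inr ⟨m, (a, false)⟩) = t m) ∧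
    (cnt v T (Sum.inl true) : ℤ) - cnt v T (Sum.inl false) = ∑ m : Fin r, (c m : ℤ) * t m

variable {c : Fin r → ℕ} {v : α → PtG n} {P : ∀ m : Fin r, Finset (Fin (n m))}

/-- The empty configuration obeys the defect law with `t = 0`. [folklore] -/
theorem hasDefectsG_empty (c : Fin r → ℕ) (v : α → PtG n) : HasDefectsG c v (∅ : Finset α) (fun _ => 0) := by
  constructor
  · intro m a; simp [cnt_empty]
  · simp [cnt_empty]

/-- **The defect law gives the signed equation at EVERY tuple of permutations** (`n_m = 2|P_m| + c_m`):
`Σ_m (2|P_m| − n_m) t_m = −Σ_m c_m t_m = −e`. [folklore] -/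
theorem signedG_of_hasDefects (hc : ∀ m, (n m : ℤ) = 2 * (P m).card + c m) {T : Finset α} {t : Fin r → ℤ}
    (h : HasDefectsG c v T t) (π : PermsG n) :
    (((cnt v T (Sum.inl true)) : ℤ) - cnt v T (Sum.inl false)) +
      ∑ m : Fin r, ∑ a : Fin (n m), (if π m a ∈ P m then ((cnt v T (Sum.inr ⟨m, (a, true)⟩) : ℤ) - cnt v T (Sum.inr ⟨m, (a, false)⟩))
        else -(((cnt v T (Sum.inr ⟨m, (a, true)⟩)) : ℤ) - cnt v T (Sum.inr ⟨m, (a, false)⟩))) = 0 := by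
  obtain ⟨hd, he⟩ := h
  have key : ∀ m : Fin r, (∑ a : Fin (n m), (if π m a ∈ P m then ((cnt v T (Sum.inr ⟨m, (a, true)⟩) : ℤ) - cnt v T (Sum.inr ⟨m, (a, false)⟩))
        else -(((cnt v T (Sum.inr ⟨m, (a, true)⟩)) : ℤ) - cnt v T (Sum.inr ⟨m, (a, false)⟩)))) = -((c m : ℤ) * t m) := by
    intro m
    rw [Finset.sum_congr rfl fun a _ => by rw [hd m a], sum_ite_mem_const (π m) (P m) (t m), hc m]
    ring
  rw [he, Finset.sum_congr rfl fun m _ => key m, Finset.sum_neg_distrib, add_neg_cancel]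

/-- **A configuration obeying the defect law is balanced at EVERY tuple of permutations.** [folklore] -/
theorem balancedG_of_hasDefects (hc : ∀ m, (n m : ℤ) = 2 * (P m).card + c m) {T : Finset α} {t : Fin r → ℤ}
    (h : HasDefectsG c v T t) (π : PermsG n) : 2 * (T.filter fun x => v x ∈ phiG P π).card = T.card :=
  balancedG_of_signed v (signedG_of_hasDefects hc h π)

/-- **… hence balanced under every set of tuples** (the defect law does not see `R`). [folklore] -/
theorem modelBalancedG_of_hasDefects (hc : ∀ m, (n m : ℤ) = 2 * (P m).card + c m) {T : Finset α} {t : Fin r → ℤ}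
    (h : HasDefectsG c v T t) (R : Finset (PermsG n)) : ModelBalancedG P R v T := fun π _ => balancedG_of_hasDefects hc h π

/-! ### All defects zero: two points over conjugate model points -/

/-- Equal fibre counts over `y` and `cjG y` when all defects vanish. [folklore] -/
theorem cnt_cjG_eq_of_hasDefects_zero {T : Finset α} {t : Fin r → ℤ} (h : HasDefectsG c v T t) (ht : ∀ m, t m = 0) (y : PtG n) :
    cnt v T (cjG y) = cnt v T y := by
  obtain ⟨hd, he⟩ := h
  have he' : ((cnt v T (Sum.inl true)) : ℤ) = cnt v T (Sum.inl false) := by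
    have h0 : ((cnt v T (Sum.inl true)) : ℤ) - cnt v T (Sum.inl false) = 0 := by
      rw [he]; exact Finset.sum_eq_zero fun m _ => by rw [ht m, mul_zero]
    linarith
  rcases y with b | ⟨m, a, b⟩
  · rw [cjG_inl]
    cases b
    · exact_mod_cast he'
    · exact_mod_cast he'.symm
  · rw [cjG_inr]
    have hd' := hd m a
    rw [ht m, sub_eq_zero] at hd'
    cases b
    · exact_mod_cast hd'
    · exact_mod_cast hd'.symm

/-- **If all defects vanish, a non-empty configuration has two distinct points over conjugate model points** (over `y` and `cjG y`: the
fibre counts of `y` and `cjG y` agree). [folklore] -/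
theorem exists_conj_of_hasDefects_zero {T : Finset α} {t : Fin r → ℤ} (h : HasDefectsG c v T t) (ht : ∀ m, t m = 0)
    (hne : T.Nonempty) : ∃ x ∈ T, ∃ x' ∈ T, x ≠ x' ∧ v x' = cjG (v x) := by
  obtain ⟨x, hx⟩ := hne
  have hcj : 0 < cnt v T (cjG (v x)) := by
    rw [cnt_cjG_eq_of_hasDefects_zero h ht]
    exact cnt_pos_of_mem hx
  obtain ⟨x', hx', hvx'⟩ := exists_mem_of_cnt_pos hcj
  refine ⟨x, hx, x', hx', fun hxx => ?_, hvx'⟩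
  rw [← hxx] at hvx'
  exact cjG_ne (v x) hvx'.symm

/-! ### A non-zero defect: a layer -/

/-- **A layer of the field `m` of sign `s`**: `n_m` points, exactly one over each model point `⟨m, (a, s)⟩` — the weight of
`⋀^{n_m} H¹(B_m)_s` (NOT a Hodge class unless `c_m = 0`). [cite: MoonenZarhin1995Duke, Thm. 2.4] -/
def IsLayerG (v : α → PtG n) (m : Fin r) (s : Bool) (L : Finset α) : Prop :=
  L.card = n m ∧ ∀ a : Fin (n m), cnt v L (Sum.inr ⟨m, (a, s)⟩) = 1

/-- The sign of a Boolean as an integer: `+1` / `−1`. [folklore] -/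
def sgnZ (s : Bool) : ℤ := if s then 1 else -1

/-- `sgnZ true = 1`. [folklore] -/
@[simp] theorem sgnZ_true : sgnZ true = 1 := rfl

/-- `sgnZ false = −1`. [folklore] -/
@[simp] theorem sgnZ_false : sgnZ false = -1 := rfl

/-- `sgnZ (¬s) = −sgnZ s`. [folklore] -/
theorem sgnZ_not (s : Bool) : sgnZ (!s) = -sgnZ s := by cases s <;> simp

/-- **Every point of a layer lies over one of its labels** (the `n_m` unit fibres exhaust the `n_m` points). [folklore] -/
theorem IsLayerG.mem_cases {m : Fin r} {s : Bool} {L : Finset α} (hL : IsLayerG v m s L) {x : α} (hx : x ∈ L) :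
    ∃ a : Fin (n m), v x = Sum.inr ⟨m, (a, s)⟩ := by
  classical
  obtain ⟨hcard, hcnt⟩ := hL
  by_contra hne
  have hne' : ∀ a : Fin (n m), v x ≠ Sum.inr ⟨m, (a, s)⟩ := fun a ha => hne ⟨a, ha⟩
  have hsub : (univ.biUnion fun a : Fin (n m) => L.filter fun z => v z = Sum.inr ⟨m, (a, s)⟩) ⊆ L.erase x := by
    intro z hz
    obtain ⟨a, -, ha⟩ := Finset.mem_biUnion.1 hz
    rw [Finset.mem_filter] at ha
    exact Finset.mem_erase.2 ⟨fun hzx => hne' a (hzx ▸ ha.2), ha.1⟩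
  have hcard' : (univ.biUnion fun a : Fin (n m) => L.filter fun z => v z = Sum.inr ⟨m, (a, s)⟩).card = n m := by
    rw [Finset.card_biUnion]
    · have h1 : ∀ a ∈ (univ : Finset (Fin (n m))), (L.filter fun z => v z = Sum.inr ⟨m, (a, s)⟩).card = 1 := fun a _ => hcnt a
      rw [Finset.sum_congr rfl h1, Finset.sum_const, Finset.card_univ, Fintype.card_fin, smul_eq_mul, mul_one]
    · intro a _ a' _ haa
      refine Finset.disjoint_filter.2 fun z _ hz hz' => haa ?_
      rw [hz] at hz'
      simp only [Sum.inr.injEq, Sigma.mk.injEq, heq_eq_eq, Prod.mk.injEq, true_and, and_true] at hz'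
      exact hz'
  have h := Finset.card_le_card hsub
  rw [hcard', Finset.card_erase_of_mem hx, hcard] at h
  have hpos : 0 < n m := by rw [← hcard]; exact Finset.card_pos.2 ⟨x, hx⟩
  omega

/-- **The model map is injective on a layer.** [folklore] -/
theorem IsLayerG.injOn {m : Fin r} {s : Bool} {L : Finset α} (hL : IsLayerG v m s L) : Set.InjOn v ↑L := by
  classical
  intro x hx x' hx' h
  obtain ⟨a, ha⟩ := hL.mem_cases hx
  have h1 : x ∈ L.filter fun z => v z = Sum.inr ⟨m, (a, s)⟩ := Finset.mem_filter.2 ⟨hx, ha⟩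
  have h2 : x' ∈ L.filter fun z => v z = Sum.inr ⟨m, (a, s)⟩ := Finset.mem_filter.2 ⟨hx', h ▸ ha⟩
  obtain ⟨z, hz⟩ := Finset.card_eq_one.1 ((cnt_eq v L _).symm.trans (hL.2 a))
  rw [hz, Finset.mem_singleton] at h1 h2
  rw [h1, h2]

/-- **Every label of a layer is hit.** [folklore] -/
theorem IsLayerG.exists_eq {m : Fin r} {s : Bool} {L : Finset α} (hL : IsLayerG v m s L) (a : Fin (n m)) :
    ∃ x ∈ L, v x = Sum.inr ⟨m, (a, s)⟩ :=
  exists_mem_of_cnt_pos (by rw [hL.2 a]; exact Nat.one_pos)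

/-- **The fibre counts of a layer**: `1` over its labels, `0` elsewhere. [folklore] -/
theorem IsLayerG.cnt_eq_ite {m : Fin r} {s : Bool} {L : Finset α} (hL : IsLayerG v m s L) (y : PtG n) :
    cnt v L y = if ∃ a : Fin (n m), y = Sum.inr ⟨m, (a, s)⟩ then 1 else 0 := by
  classical
  split_ifs with h
  · obtain ⟨a, rfl⟩ := h
    exact hL.2 a
  · rw [cnt, Finset.card_eq_zero, Finset.filter_eq_empty_iff]
    intro x hx hvx
    obtain ⟨a, ha⟩ := hL.mem_cases hx
    exact h ⟨a, hvx ▸ ha⟩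

/-- **A non-zero defect `t_{m₀}` yields a layer of the field `m₀` inside the configuration, of the sign `s` of `t_{m₀}`**
(`sgnZ s · t_{m₀} > 0`): each pair `a` carries at least `|t_{m₀}| ≥ 1` points of that sign; choose one over each.
[cite: MoonenZarhin1995Duke, Thm. 2.4] -/
theorem exists_layer_of_hasDefects {T : Finset α} {t : Fin r → ℤ} (h : HasDefectsG c v T t) {m₀ : Fin r} (hm : t m₀ ≠ 0) :
    ∃ (s : Bool) (L : Finset α), L ⊆ T ∧ IsLayerG v m₀ s L ∧ 0 < sgnZ s * t m₀ := by
  classical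
  obtain ⟨hd, -⟩ := h
  -- every pair carries a point of the sign of `t m₀`
  have main : ∀ s : Bool, 0 < sgnZ s * t m₀ → ∃ L : Finset α, L ⊆ T ∧ IsLayerG v m₀ s L := by
    intro s hs
    have hcnt : ∀ a : Fin (n m₀), 0 < cnt v T (Sum.inr ⟨m₀, (a, s)⟩) := by
      intro a
      have hda := hd m₀ a
      have h1 : (0 : ℤ) ≤ cnt v T (Sum.inr ⟨m₀, (a, false)⟩) := Int.natCast_nonneg _
      have h2 : (0 : ℤ) ≤ cnt v T (Sum.inr ⟨m₀, (a, true)⟩) := Int.natCast_nonneg _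
      cases s
      · rw [sgnZ_false] at hs
        have : (0 : ℤ) < cnt v T (Sum.inr ⟨m₀, (a, false)⟩) := by linarith
        exact_mod_cast this
      · rw [sgnZ_true] at hs
        have : (0 : ℤ) < cnt v T (Sum.inr ⟨m₀, (a, true)⟩) := by linarith
        exact_mod_cast this
    choose x hxT hvx using fun a => exists_mem_of_cnt_pos (hcnt a)
    have hxinj : Function.Injective x := fun a a' haa => by
      have h := hvx a
      rw [haa, hvx a'] at h
      simp only [Sum.inr.injEq, Sigma.mk.injEq, heq_eq_eq, Prod.mk.injEq, true_and, and_true] at h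
      exact h.symm
    refine ⟨univ.image x, fun z hz => ?_, ?_, fun a => ?_⟩
    · obtain ⟨a, -, rfl⟩ := Finset.mem_image.1 hz
      exact hxT a
    · rw [Finset.card_image_of_injective _ hxinj, Finset.card_univ, Fintype.card_fin]
    · rw [cnt, Finset.card_eq_one]
      refine ⟨x a, ?_⟩
      ext z
      simp only [Finset.mem_filter, Finset.mem_image, Finset.mem_univ, true_and, Finset.mem_singleton]
      constructor
      · rintro ⟨⟨a', rfl⟩, hz⟩
        have h := hvx a'
        rw [hz] at h
        simp only [Sum.inr.injEq, Sigma.mk.injEq, heq_eq_eq, Prod.mk.injEq, true_and, and_true] at h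
        rw [h]
      · rintro rfl
        exact ⟨⟨a, rfl⟩, hvx a⟩
  by_cases h0 : 0 < t m₀
  · obtain ⟨L, hLT, hL⟩ := main true (by rw [sgnZ_true, one_mul]; exact h0)
    exact ⟨true, L, hLT, hL, by rw [sgnZ_true, one_mul]; exact h0⟩
  · have hneg : 0 < sgnZ false * t m₀ := by
      rw [sgnZ_false]
      have h2 : t m₀ < 0 := lt_of_le_of_ne (not_lt.1 h0) hm
      linarith
    obtain ⟨L, hLT, hL⟩ := main false hneg
    exact ⟨false, L, hLT, hL, hneg⟩

/-- **The fibre counts after removing a layer of sign `s` of the field `m₀`**: `1` less over each of its labels, unchanged elsewhere.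
[folklore] -/
theorem cnt_sdiff_layer [DecidableEq α] {T L : Finset α} {m₀ : Fin r} {s : Bool} (hLT : L ⊆ T) (hL : IsLayerG v m₀ s L)
    (y : PtG n) : (cnt v (T \ L) y : ℤ) = cnt v T y - if ∃ a : Fin (n m₀), y = Sum.inr ⟨m₀, (a, s)⟩ then 1 else 0 := by
  rw [cnt_sdiff hLT, Nat.cast_sub (cnt_le_cnt_of_subset hLT y), hL.cnt_eq_ite]
  push_cast
  split_ifs <;> simp

end Summit.HodgeConjecture.CorCM.Census.MultiFieldWeil
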